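import Summits.ValiantsHypothesis.ValiantsHypothesis.Theses.PermanentalCones
import Literature.Computability.AlgebraicComplexity.DeterminantalComplexityProofs
import Literature.Computability.AlgebraicComplexity.VPDeterminantalQPProofs

/-!
# ValiantsHypothesis / PermanentalCones — `DetToVP` (pencil form ⇒ family form)

Route `PermanentalCones`, item `stmt-ValiantsHypothesis-8657` (support, rank 9):
`HyperbolicDetShadow → HyperbolicVPShadow`.

Proof. Let `f = (f_n)` be a real family whose complexification is a `VP_ℂ` family. By the
proved tree facts `isQPBounded_determinantalComplexity_of_isVPFamily_holds` and
`hasDetRepr_determinantalComplexity_holds`, `map ℂ f_n = det M_n` for a complex affine pencil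
`M_n` of size `N_n ≤ 2^{(log₂ n + a)^a}`. Write `M_n = P + i Q` with `P`, `Q` real affine pencils
(coefficientwise real and imaginary parts); the real `2N_n × 2N_n` pencil `[[P, -Q], [Q, P]]`
has determinant `det (P + iQ) · det (P − iQ) = f_n · f_n` (block triangularisation over `ℂ`,
`det (P − iQ) = conj (det M_n) = f_n`). The square `f_n · f_n` is homogeneous, hyperbolic with
respect to `e_n`, and has the same closed hyperbolicity cone as `f_n`; `HyperbolicDetShadow`
gives a lifted-LMI description of size `m ≤ 2^{(log₂ (2 N_n) + c)^c}`, and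
`(log₂ (2N_n) + c)^c ≤ ((log₂ n + a)^a + 1 + c)^c ≤ (log₂ n + c')^{c'}` for
`c' = (a+1)(c+1) + a + c + 2`.
-/

-- `<Problem> = <Summit>` for this single-conjunct summit (lakefile sets the same option tree-wide).
set_option linter.dupNamespace false

namespace Summit.ValiantsHypothesis.ValiantsHypothesis.Theorems

open MvPolynomial Literature.Computability.AlgebraicComplexity

/-- Block triangularisation of the realification of a complex matrix: over any commutative ring
containing a square root `J` of `-1`, `det [[A, -B], [B, A]] = det (A + J B) · det (A − J B)`.
[folklore] -/
theorem permanentalCones_det_fromBlocks_neg_self {S : Type*} [CommRing S] {ι : Type*}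
    [Fintype ι] [DecidableEq ι] (J : S) (hJ : J * J = -1) (A B : Matrix ι ι S) :
    (Matrix.fromBlocks A (-B) B A).det = (A + J • B).det * (A - J • B).det := by
  have h1 : Matrix.fromBlocks (1 : Matrix ι ι S) (J • (1 : Matrix ι ι S)) 0 1 *
      Matrix.fromBlocks A (-B) B A * Matrix.fromBlocks (1 : Matrix ι ι S) (-(J • 1)) 0 1 =
      Matrix.fromBlocks (A + J • B) 0 B (A - J • B) := by
    simp only [Matrix.fromBlocks_multiply, Matrix.one_mul, Matrix.mul_one, Matrix.zero_mul,
      Matrix.mul_zero, Matrix.smul_mul, Matrix.mul_smul, Matrix.mul_neg, smul_add,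
      smul_smul, hJ, neg_smul, one_smul, zero_add, add_zero]
    congr 1
    · abel
    · abel
  have h2 := congrArg Matrix.det h1
  rw [Matrix.det_mul, Matrix.det_mul, Matrix.det_fromBlocks_zero₂₁,
    Matrix.det_fromBlocks_zero₂₁, Matrix.det_fromBlocks_zero₁₂] at h2
  simpa using h2

/-- Coefficientwise real and imaginary parts of a complex polynomial, as real polynomials of no
larger total degree. [folklore] -/
theorem permanentalCones_exists_re_im_parts {σ : Type*} (p : MvPolynomial σ ℂ) :
    ∃ a b : MvPolynomial σ ℝ,
      (∀ m, coeff m a = (coeff m p).re) ∧ (∀ m, coeff m b = (coeff m p).im) ∧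
      a.totalDegree ≤ p.totalDegree ∧ b.totalDegree ≤ p.totalDegree := by
  classical
  refine ⟨∑ n ∈ p.support, monomial n (coeff n p).re,
    ∑ n ∈ p.support, monomial n (coeff n p).im, fun m => ?_, fun m => ?_, ?_, ?_⟩
  · rw [coeff_sum]
    simp only [coeff_monomial]
    rw [Finset.sum_ite_eq']
    split_ifs with h
    · rfl
    · rw [notMem_support_iff.1 h, Complex.zero_re]
  · rw [coeff_sum]
    simp only [coeff_monomial]
    rw [Finset.sum_ite_eq']
    split_ifs with h
    · rfl
    · rw [notMem_support_iff.1 h, Complex.zero_im]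
  · exact totalDegree_finsetSum_le fun n hn =>
      (totalDegree_monomial_le _ _).trans (le_totalDegree hn)
  · exact totalDegree_finsetSum_le fun n hn =>
      (totalDegree_monomial_le _ _).trans (le_totalDegree hn)

/-- Realification of a complex affine determinantal representation: if the complexification of
a real polynomial `f` has an affine determinantal representation of size `N` over `ℂ`, then
`f * f` has one of size `2N` over `ℝ` (the real pencil `[[P, -Q], [Q, P]]` of `M = P + iQ`,
whose determinant is `det M · det (conj M) = f · f`). [folklore] -/
theorem permanentalCones_hasDetRepr_mul_self_of_complex {σ : Type*} (f : MvPolynomial σ ℝ)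
    {N : ℕ} (h : HasDetRepr (MvPolynomial.map (algebraMap ℝ ℂ) f) N) :
    HasDetRepr (f * f) (2 * N) := by
  classical
  obtain ⟨M, hdeg, hdet⟩ := h
  choose a b ha hb hdega hdegb using
    fun i j => permanentalCones_exists_re_im_parts (M i j)
  set φ : MvPolynomial σ ℝ →+* MvPolynomial σ ℂ := MvPolynomial.map (algebraMap ℝ ℂ) with hφ
  set I' : MvPolynomial σ ℂ := C Complex.I with hI'
  let P : Matrix (Fin N) (Fin N) (MvPolynomial σ ℝ) := Matrix.of a
  let Q : Matrix (Fin N) (Fin N) (MvPolynomial σ ℝ) := Matrix.of b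
  let R : Matrix (Fin N ⊕ Fin N) (Fin N ⊕ Fin N) (MvPolynomial σ ℝ) :=
    Matrix.fromBlocks P (-Q) Q P
  let e : Fin N ⊕ Fin N ≃ Fin (2 * N) := finSumFinEquiv.trans (finCongr (two_mul N).symm)
  have hRdeg : ∀ i j, (R i j).totalDegree ≤ 1 := by
    rintro (i | i) (j | j)
    · simpa [R, P] using (hdega i j).trans (hdeg i j)
    · simpa [R, Q, totalDegree_neg] using (hdegb i j).trans (hdeg i j)
    · simpa [R, Q] using (hdegb i j).trans (hdeg i j)
    · simpa [R, P] using (hdega i j).trans (hdeg i j)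
  refine ⟨Matrix.reindex e e R, fun i j => ?_, ?_⟩
  · rw [Matrix.reindex_apply, Matrix.submatrix_apply]
    exact hRdeg _ _
  · rw [Matrix.det_reindex_self]
    apply MvPolynomial.map_injective (algebraMap ℝ ℂ) (RingHom.injective _)
    -- `M = P + i Q` and `conj M = P - i Q`, coefficientwise
    have hab : ∀ i j, φ (a i j) + I' * φ (b i j) = M i j := fun i j => by
      ext m
      simp only [hφ, hI', coeff_add, coeff_map, coeff_C_mul, ha, hb, Complex.ext_iff]
      constructor <;> simp
    have hab' : ∀ i j, φ (a i j) - I' * φ (b i j) =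
        MvPolynomial.map (starRingEnd ℂ) (M i j) := fun i j => by
      ext m
      simp only [hφ, hI', coeff_sub, coeff_map, coeff_C_mul, ha, hb, Complex.ext_iff]
      constructor <;> simp
    have hPQ : P.map φ + I' • Q.map φ = M := by
      ext i j
      simp [P, Q, Matrix.smul_apply, hab i j]
    have hPQ' : P.map φ - I' • Q.map φ = M.map (MvPolynomial.map (starRingEnd ℂ)) := by
      ext i j
      simp [P, Q, Matrix.smul_apply, hab' i j]
    have hI : I' * I' = -1 := by
      rw [hI', ← C_mul, Complex.I_mul_I, C_neg, C_1]
    have hconj : (M.map (MvPolynomial.map (starRingEnd ℂ))).det =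
        MvPolynomial.map (algebraMap ℝ ℂ) f := by
      have := (RingHom.map_det (MvPolynomial.map (starRingEnd ℂ)) M).symm
      rw [RingHom.mapMatrix_apply] at this
      rw [this, hdet, map_map,
        show (starRingEnd ℂ).comp (algebraMap ℝ ℂ) = algebraMap ℝ ℂ from
          RingHom.ext fun r => Complex.conj_ofReal r]
    rw [← hφ, RingHom.map_det φ, RingHom.mapMatrix_apply, Matrix.fromBlocks_map,
      Matrix.map_neg _ (map_neg φ), permanentalCones_det_fromBlocks_neg_self I' hI, hPQ, hPQ',
      hconj, map_mul, hφ, hdet]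

/-- **`DetToVP`** (item `stmt-ValiantsHypothesis-8657`, route `PermanentalCones`): the pencil
form `HyperbolicDetShadow` of the transfer implies the family form `HyperbolicVPShadow`.
For a real family with complexification in `VP_ℂ`, `dc_ℂ (f_n) ≤ 2^{(log₂ n + a)^a}`
(`isQPBounded_determinantalComplexity_of_isVPFamily_holds`, attained by
`hasDetRepr_determinantalComplexity_holds`); realify the complex pencil to a real pencil of
double size with determinant `f_n · f_n`, which is homogeneous, hyperbolic w.r.t. `e_n` and has
the same closed cone as `f_n`; apply `HyperbolicDetShadow` and compose the quasi-polynomial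
bounds. [folklore] -/
theorem permanentalCones_detToVP_proof :
    Summit.ValiantsHypothesis.ValiantsHypothesis.Theses.PermanentalCones.DetToVP := by
  unfold Summit.ValiantsHypothesis.ValiantsHypothesis.Theses.PermanentalCones.DetToVP
    Summit.ValiantsHypothesis.ValiantsHypothesis.Theses.PermanentalCones.HyperbolicDetShadow
    Summit.ValiantsHypothesis.ValiantsHypothesis.Theses.PermanentalCones.HyperbolicVPShadow
  rintro ⟨c, hc⟩ v f e hVP hhom hhyp
  -- quasi-polynomial determinantal complexity of the complexified family
  obtain ⟨a, ha⟩ := isQPBounded_determinantalComplexity_of_isVPFamily_holds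
    (k := ℂ) (σ := fun n => Fin (v n)) (fun n => MvPolynomial.map (algebraMap ℝ ℂ) (f n)) hVP
  refine ⟨(a + 1) * (c + 1) + a + c + 2, fun n => ?_⟩
  set N := determinantalComplexity (MvPolynomial.map (algebraMap ℝ ℂ) (f n)) with hN
  have hNle : N ≤ 2 ^ ((Nat.log 2 n + a) ^ a) := ha n
  -- a real affine pencil of size 2N for f_n * f_n
  obtain ⟨M, hM⟩ := permanentalCones_hasDetRepr_mul_self_of_complex (f n)
    (hasDetRepr_determinantalComplexity_holds _)
  -- hypotheses of the pencil form for f_n * f_n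
  have hhom2 : ∃ d : ℕ, (f n * f n).IsHomogeneous d := by
    obtain ⟨d, hd⟩ := hhom n
    exact ⟨d + d, hd.mul hd⟩
  have hhyp2 : MvPolynomial.eval (e n) (f n * f n) ≠ 0 ∧
      ∀ (x : Fin (v n) → ℝ) (z : ℂ), MvPolynomial.eval (fun j => (x j : ℂ) + z * (e n j : ℂ))
        (MvPolynomial.map (algebraMap ℝ ℂ) (f n * f n)) = 0 → z.im = 0 := by
    refine ⟨?_, fun x z hz => (hhyp n).2 x z ?_⟩
    · rw [map_mul]
      exact mul_ne_zero (hhyp n).1 (hhyp n).1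
    · rw [map_mul, map_mul] at hz
      exact mul_self_eq_zero.1 hz
  obtain ⟨m, hm, p, A, B, hrep⟩ := hc (v n) (2 * N) (f n * f n) M (e n) hM hhom2 hhyp2
  refine ⟨m, hm.trans ?_, p, A, B, fun x => ?_⟩
  · -- compose the two quasi-polynomial bounds
    apply Nat.pow_le_pow_right (by norm_num)
    set L := Nat.log 2 n with hL
    set t := L + a + c + 2 with ht
    have hlog : Nat.log 2 (2 * N) ≤ (L + a) ^ a + 1 := by
      calc Nat.log 2 (2 * N) ≤ Nat.log 2 (2 * 2 ^ ((L + a) ^ a)) :=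
            Nat.log_mono_right (Nat.mul_le_mul_left 2 hNle)
        _ = (L + a) ^ a + 1 := by
            rw [← Nat.pow_succ', Nat.log_pow (by norm_num)]
    have hbase : (L + a) ^ a + 1 + c ≤ t ^ (a + 1) := by
      rcases Nat.eq_zero_or_pos a with rfl | hapos
      · simp only [add_zero, pow_zero, zero_add, pow_one, ht]
        omega
      · have h1 : (L + a) ^ a ≤ t ^ a := Nat.pow_le_pow_left (by omega) a
        have h2 : t ≤ t ^ a := Nat.le_self_pow (by omega) t
        have h3 : t ^ (a + 1) = t ^ a * t := pow_succ t a
        have h4 : 2 ≤ t := by omega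
        nlinarith
    calc (Nat.log 2 (2 * N) + c) ^ c ≤ ((L + a) ^ a + 1 + c) ^ c :=
          Nat.pow_le_pow_left (by omega) c
      _ ≤ (t ^ (a + 1)) ^ c := Nat.pow_le_pow_left hbase c
      _ = t ^ ((a + 1) * c) := by rw [← Nat.pow_mul]
      _ ≤ (L + ((a + 1) * (c + 1) + a + c + 2)) ^ ((a + 1) * c) :=
          Nat.pow_le_pow_left (by rw [ht]; nlinarith) _
      _ ≤ (L + ((a + 1) * (c + 1) + a + c + 2)) ^ ((a + 1) * (c + 1) + a + c + 2) :=
          Nat.pow_le_pow_right (by omega) (by nlinarith)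
  · -- the closed cones of f_n and f_n * f_n coincide
    refine Iff.trans (forall_congr' fun τ => ?_) (hrep x)
    rw [map_mul]
    exact imp_congr_right fun _ => mul_self_ne_zero.symm

end Summit.ValiantsHypothesis.ValiantsHypothesis.Theorems
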